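import Summits.Langlands.Langlands.Theses.DyadicOddResidue
import Summits.Langlands.Langlands.Theorems.DyadicOddResidueOddPrimesRegularFM
import Summits.Langlands.Langlands.Theorems.ParityBlindBianchiResidualBianchiDoorMod2SerreKW
import Summits.Langlands.Langlands.Theorems.ParityBlindBianchiResidualBianchiDoorMod2ReducibleSolvable
import Literature.NumberTheory.EllipticCurves.NewformGaloisRepModLOfPadicAlgClProofs
import Literature.NumberTheory.GaloisRepresentations.CalegariEvenFontaineMazurTwo
import Literature.NumberTheory.Automorphic.FontaineMazurGL2DyadicNonsolvable
import HarnessLib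

/-!
# `DyadicOddResidue.DyadicNonsolvableFM` (crux stmt-Langlands-18744) from Tung 2020 and
# Khare–Wintenberger: the Serre avatar of `ρ̄`, modus ponens, and the Tate untwist at `ℓ = 2`

The route decl `Summit.Langlands.Langlands.Theses.DyadicOddResidue.DyadicNonsolvableFM` is the
Fontaine–Mazur conjecture for `GL₂/ℚ` at the prime `ℓ = 2` in the regular case for residual
representations that are absolutely irreducible with NON-SOLVABLE image, in the summit's
automorphic `L`-normalisation (an `L`-algebraic cuspidal `π` of `GL₂(𝔸_ℚ)`, Satake–Frobenius
compatible with `ρ` at almost all places).  It is a PRINTED THEOREM: Tung, Math. Z. 298 (2021),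
Thm. 1 ("`p = 2` … `ρ̄` is modular, `ρ̄` has non-solvable image ⟹ `ρ` is modular"), the residual
modularity being Serre's conjecture (Khare–Wintenberger 2009 with Kisin 2009, all `p` including
`2`; Tung's own remark after Thm. 1).  Line `Sketch` (idea `serre-avatar-modus-ponens`) of the crux:

* `exists_cuspidal_satakeFrobCompatible_of_tateTwistNewform` — the newform → `L`-algebraic `π`
  CONVERSION with a Tate twist absorbed, at ANY prime `ℓ` and for ONE `ρ` (the proof body of the
  accepted `oddPrimesRegularFM_of_tateTwistModularity`, which used its guard `ℓ ≠ 2` only to feed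
  its hypothesis): conjugate newform ↦ `L`-algebraic `π₂` with Satake parameters the inverted Hecke
  roots (`exists_isLAlgebraic_hasSatakeParamAt_rootsInv_of_isNewform1`), norm twist
  `π = π₂ ⊗ |det|^{-m}`, `ε(Frob_q) = q`, `arithFrobPolyOfSatake_one_rootsInv_smul`.
* `isOpen_ker_residualRepChosen`, `exists_discreteModel_residualRep` — the SERRE AVATAR: the chosen
  residual representation `ρ.residualRep` of `ρ : Γ_ℚ → GL₂(ℚ̄_p)` with non-solvable image,
  pushed along any `ι : ℤ̄_p/𝔪 →+* k` into a discrete field `k`, underlies a continuous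
  `τ : FramedGaloisRep ℚ k 2` (open kernel, Deligne–Serre 6.12) which is irreducible (a reducible
  `GL₂`-representation has solvable image).
* `dyadicNonsolvableFM_of_Tung2020` — the crux BY NAME from the named facts
  `Tung2020_fontaineMazurGL2_two_tateTwist` (Tung 2020 Thm. 1, Tate-twist rendering, residual
  modularity in Serre's shape) and `khare_wintenberger 2 k` (which discharges that shape by
  `exists_newform_of_odd_irreducible_of_khare_wintenberger`, oddness being automatic in
  characteristic `2`, `isOdd_of_charP_two`), over the model `k = \overline{ℤ̄₂/𝔪}`.

CONDITIONAL result (D-0014): trust base {`Tung2020_fontaineMazurGL2_two_tateTwist`,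
`khare_wintenberger 2 ·`}, both irreducibly XL printed theorems.  No statement of the route file is
altered; the route decl is concluded BY NAME.  Sorry-free; axioms `propext`, `Classical.choice`,
`Quot.sound`.
-/

noncomputable section


open scoped MatrixGroups Classical Polynomial NumberField
open NumberField IsDedekindDomain Filter Polynomial CongruenceSubgroup Field
open Literature.NumberTheory.Automorphic Literature.NumberTheory.EllipticCurves.ModularForms
  Literature.NumberTheory.GaloisRepresentations
open Summit.Langlands.Langlands.Cruxes.SerreKWAutomorphicGL2.AdelicNewformDatumDoubleTwist

namespace Summit.Langlands.Langlands.Theorems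

set_option linter.dupNamespace false -- project-wide option; `Summit.Langlands.Langlands` is the mandated namespace

open Rat.HeightOneSpectrum

/-! ## The conversion: newform up to a Tate twist ⟹ `L`-algebraic cuspidal `π`, at any prime -/

/-- **Newform modularity up to a Tate twist gives the summit's automorphic conclusion** (any prime
`ℓ`, one `ρ`).  Let `ρ : Γ_ℚ → GL₂(ℚ̄_ℓ)` be continuous and suppose some Tate twist `ρ ⊗ χ`,
`χ = ε_ℓ^m` (`m ∈ ℤ`), is attached away from `N ℓ` to a newform `f ∈ S_k(Γ₁(N))` along
`ι_f : K_f → ℚ̄_ℓ` (`IsGaloisRepOfNewform1`: unramified at `q ∤ N ℓ` with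
`charpoly (ρ ⊗ χ)(Frob_q) = ι_f(X² - a_q X + ε_f(q) q^{k-1})`).  Then for every level witness `hcpt`
and `ι : ℚ̄_ℓ ≃ ℂ` there is an `L`-algebraic cuspidal `π` of `GL₂(𝔸_ℚ)` Satake–Frobenius compatible
with `ρ` at almost all places: `π = π₂(f^τ) ⊗ |det|^{-m}` (`τ = ι ∘ ι_f`;
`exists_isLAlgebraic_hasSatakeParamAt_rootsInv_of_isNewform1`, `exists_twist_hasInfinityType`) has
Satake parameter `q^m {β₁⁻¹, β₂⁻¹}` at `v = q ∤ N ℓ` outside the exceptional set of `π₂`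
(`HasSatakeParamAt.of_map_mulChar_detTwist_of_cpow`), `ρ = (ρ ⊗ ε^m) ⊗ ε^{-m}` is unramified there
(`cyclotomicPadicAlgCl_eq_one_of_mem_inertia`) and `charpoly ρ(Frob_v) = X² - q^{-m} ι_f(a_q) X +
q^{-2m} ι_f(ε_f(q) q^{k-1}) = arithFrobPolyOfSatake ι q 1 (q^m {β_j⁻¹})` (`ε(Frob_q) = q`,
`charpoly_eq_of_charpoly_twist_eq`, `arithFrobPolyOfSatake_one_rootsInv_smul`).  This is the proof
body of the accepted `oddPrimesRegularFM_of_tateTwistModularity`, which used its guard `ℓ ≠ 2` only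
to feed its hypothesis. [cite: BuzzardGeeLMS2014, Conj. 3.2.2 and Rem. 3.2.5]
[cite: SerreAbelianLadic1968, Ch. I §1.2 (Example: the cyclotomic character)] -/
theorem exists_cuspidal_satakeFrobCompatible_of_tateTwistNewform {ℓ : ℕ} [Fact ℓ.Prime]
    (ρ : FramedGaloisRep ℚ (PadicAlgCl ℓ) 2) {χ : absoluteGaloisGroup ℚ →ₜ* (PadicAlgCl ℓ)ˣ} {m : ℤ}
    (hχ : ∀ σ, χ σ = cyclotomicPadicAlgCl ℚ ℓ σ ^ m) {N : ℕ} [NeZero N] {k : ℤ}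
    {f : CuspForm (Gamma1 N) k} {ιf : coeffCharField f →+* PadicAlgCl ℓ} (hf : IsNewform1 f)
    (hρ' : IsGaloisRepOfNewform1 f ιf {q | q ∣ N * ℓ} (FramedRep.twist ρ χ))
    (hcpt : isCompact_glFiniteIntegralLevel 2 ℚ) (ι : PadicAlgCl ℓ ≃+* ℂ) :
    ∃ π : CuspidalAutomorphicRepData 2 ℚ hcpt, π.1.IsLAlgebraic ∧
      ∀ᶠ v : HeightOneSpectrum (𝓞 ℚ) in cofinite, Summit.Langlands.SatakeFrobCompatibleAt ι π.1 ρ v := by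
  have hℓp : ℓ.Prime := Fact.out
  -- the automorphic side: `π₂ = π(f^τ)` (L-normalised) and its norm twist `π = π₂ ⊗ |det|^{-m}`
  set τ : coeffCharField f →+* ℂ := (ι : PadicAlgCl ℓ →+* ℂ).comp ιf with hτdef
  obtain ⟨π₂, ⟨T, hT, hTL⟩, hsat₂⟩ :=
    exists_isLAlgebraic_hasSatakeParamAt_rootsInv_of_isNewform1 hf τ hcpt
  obtain ⟨η, π, hη, hW, hW', hTπ⟩ :=
    CuspidalAutomorphicRepData.exists_twist_hasInfinityType π₂ (((-m : ℤ) : ℝ)) hT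
  refine ⟨π, ⟨_, hTπ, ?_⟩, ?_⟩
  · rw [Complex.ofReal_intCast]
    exact (InfinityType.isLAlgebraic_twist_intCast_iff T (-m)).2 hTL
  have hgood := eventually_not_dvd (n := N * ℓ) (mul_ne_zero (NeZero.ne N) hℓp.ne_zero)
  filter_upwards [hsat₂, hgood] with v hv₂ hvNℓ
  -- notation at the good place `v`: `q = p_v`, `q ∤ N ℓ`
  have hq : ((Rat.HeightOneSpectrum.primesEquiv v : Nat.Primes) : ℕ) = natGenerator v := rfl
  have hℓv : (ℓ : 𝓞 ℚ) ∉ v.asIdeal := fun h =>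
    hvNℓ (hq ▸ Dvd.dvd.mul_left ((Rat.natCast_mem_asIdeal_iff v).1 h) N)
  obtain ⟨hunr', hfrob'⟩ := hρ' v hvNℓ
  have hsatπ := AutomorphicRepData.HasSatakeParamAt.of_map_mulChar_detTwist_of_cpow hη hW hW' hv₂
  refine ⟨_, hsatπ, ?_, ?_⟩
  · -- `ρ` is unramified at `v`: `ρ ⊗ ε^m` is, and `ε` is
    intro 𝔓 h𝔓 σ hσ
    refine apply_eq_one_of_twist_apply_eq_one ρ χ ?_ (hunr' 𝔓 h𝔓 σ hσ)
    rw [hχ, cyclotomicPadicAlgCl_eq_one_of_mem_inertia ℓ hℓv h𝔓 hσ, one_zpow]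
  · -- the Frobenius polynomial
    intro 𝔓 h𝔓 σ hσ
    have h2 := hfrob' 𝔓 h𝔓 σ hσ
    -- the Hecke polynomial of `f` at `q`, along `ι_f` and along `τ = ι ∘ ι_f`
    set aK : coeffCharField f := ⟨(UpperHalfPlane.qExpansion 1 ⇑f).coeff (natGenerator v),
      cuspCoeff_mem_coeffCharField f _⟩ with haK
    set bK : coeffCharField f := ⟨(nebentypus f ((natGenerator v : ℕ) : ZMod N) : ℂ) *
        ((natGenerator v : ℕ) : ℂ) ^ (k - 1), nebentypus_mul_zpow_mem_coeffCharField f _⟩ with hbK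
    have hH : heckePolynomial f (natGenerator v) = X ^ 2 - C aK * X + C bK := rfl
    rw [hq, hH, Polynomial.map_add, Polynomial.map_sub, Polynomial.map_mul, Polynomial.map_pow,
      map_X, map_C, map_C] at h2
    have hρσ := charpoly_eq_of_charpoly_twist_eq ρ χ σ h2
    -- `χ(σ) = ε(σ)^m = q^m`
    have hc : ((χ σ : (PadicAlgCl ℓ)ˣ) : PadicAlgCl ℓ) = ((natGenerator v : ℕ) : PadicAlgCl ℓ) ^ m := by
      rw [hχ, Units.val_zpow_eq_zpow_val, coe_cyclotomicPadicAlgCl_of_isArithFrobAt ℓ hℓv h𝔓 hσ,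
        Rat.residueCard_eq_natGenerator]
    rw [hρσ, hq, hH, Polynomial.map_add, Polynomial.map_sub, Polynomial.map_mul, Polynomial.map_pow,
      map_X, map_C, map_C, arithFrobPolyOfSatake_one_rootsInv_smul]
    -- compare coefficients: `ι⁻¹(w⁻¹) = q^{-m} = χ(σ)⁻¹`, `ι⁻¹ ∘ τ = ι_f`
    have hw : ι.symm ((v.residueCard : ℂ) ^ (-((((-m : ℤ) : ℝ)) : ℂ)))⁻¹ =
        (((natGenerator v : ℕ) : PadicAlgCl ℓ) ^ m)⁻¹ := by
      rw [Rat.residueCard_eq_natGenerator, Complex.ofReal_intCast, ← Int.cast_neg, neg_neg,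
        Complex.cpow_intCast, map_inv₀, map_zpow₀, map_natCast]
    have hτ : ∀ x : coeffCharField f, ι.symm (τ x) = ιf x := fun x => by
      rw [hτdef, RingHom.comp_apply]
      exact ι.symm_apply_apply _
    rw [hw, hτ, hτ, hc]

/-! ## The Serre avatar of the chosen residual representation -/

section SerreAvatar

open IsLocalRing Literature.NumberTheory.EllipticCurves.ModularForms.DeligneSerre1974

variable {p : ℕ} [Fact p.Prime] {K : Type} [Field K] {n : ℕ}

/-- **The chosen residual representation `ρ.residualRep` of `ρ : Γ_K → GL_n(ℚ̄_p)` has open kernel**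
as soon as it is a genuine residual representation: it is a semisimplification `σ` of a reduction
`τ₀ = Q (ρ₀ mod 𝔪) Q⁻¹` of an integral model `ρ₀` over `ℤ̄_p` with `ker τ₀ ≤ ker σ`
(`IsSemisimplificationOf`), and `ker (ρ₀ mod 𝔪)` is open because `𝔪 = {‖x‖ < 1}` is open in `ℚ̄_p`
(`isOpen_ker_residualRep`, Deligne–Serre 1974, (6.12)). [cite: DeligneSerreASENS1974, §6.12] -/
theorem isOpen_ker_residualRepChosen (ρ : FramedGaloisRep K (PadicAlgCl p) n)
    (hex : ∃ τ, ρ.IsResidualRepOf (RingHom.id _) τ) :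
    IsOpen (ρ.residualRep.ker : Set (absoluteGaloisGroup K)) := by
  obtain ⟨τ₀, ⟨ρ₀, Q, ⟨P, hP⟩, hτ₀⟩, hss⟩ := ρ.residualRep_spec hex
  have hmemO : ∀ x : PadicAlgCl p, x ∈ (padicAlgClIntegers p) ↔ Valued.v x ≤ 1 := fun x ↦
    Valuation.mem_valuationSubring_iff _ _
  have hmopen : IsOpen {x : PadicAlgCl p | ∃ h : x ∈ padicAlgClIntegers p,
      (⟨x, h⟩ : padicAlgClIntegers p) ∈ maximalIdeal (padicAlgClIntegers p)} := by
    have hmax : {x : PadicAlgCl p | ∃ h : x ∈ padicAlgClIntegers p,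
        (⟨x, h⟩ : padicAlgClIntegers p) ∈ maximalIdeal (padicAlgClIntegers p)} =
        {x : PadicAlgCl p | Valued.v x < 1} := by
      ext x
      constructor
      · rintro ⟨hx, hm⟩
        exact (mem_maximalIdeal_padicAlgClIntegers_iff ⟨x, hx⟩).mp hm
      · intro hx
        exact ⟨(hmemO x).mpr (le_of_lt hx), (mem_maximalIdeal_padicAlgClIntegers_iff _).mpr hx⟩
    rw [hmax]
    have hball : {x : PadicAlgCl p | Valued.v x < 1} = Metric.ball (0 : PadicAlgCl p) 1 := by
      ext x
      simp only [Set.mem_setOf_eq, Metric.mem_ball, dist_zero_right]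
      rw [PadicAlgCl.valuation_def, ← NNReal.coe_lt_coe, coe_nnnorm, NNReal.coe_one]
    rw [hball]
    exact Metric.isOpen_ball
  have hker₀ : IsOpen ((((Matrix.GeneralLinearGroup.map (residue (padicAlgClIntegers p))).comp ρ₀).ker :
      Subgroup (absoluteGaloisGroup K)) : Set (absoluteGaloisGroup K)) :=
    Literature.NumberTheory.GaloisRepresentations.isOpen_ker_residualRep hmopen hP
  refine Subgroup.isOpen_mono ?_ hker₀
  intro g hg
  rw [MonoidHom.mem_ker] at hg
  apply hss.2.2
  rw [MonoidHom.mem_ker, hτ₀ g]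
  have hred : integralReduction (RingHom.id _) ρ₀ g = 1 := by
    change Matrix.GeneralLinearGroup.map ((RingHom.id _).comp (residue (padicAlgClIntegers p))) (ρ₀ g) = 1
    rw [RingHom.id_comp]
    exact hg
  rw [hred, mul_one, mul_inv_cancel]

/-- **The Serre avatar.**  For `ρ : Γ_K → GL₂(ℚ̄_p)` continuous whose chosen residual representation
`ρ̄ = ρ.residualRep` has non-solvable image, and every discrete field `k` receiving `ℤ̄_p/𝔪` along
`ι`, the push-forward `GL₂(ι) ∘ ρ̄` underlies a continuous `τ : FramedGaloisRep K k 2` (open kernel: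
`isOpen_ker_residualRepChosen`; the junk value `residualRep = 1`, whose range is solvable, is excluded
by the hypothesis itself) which is irreducible (a reducible `GL₂`-representation has solvable image,
`isSolvable_range_of_not_isIrreducible`, and `GL₂(ι)` is injective). [folklore] -/
theorem exists_discreteModel_residualRep (ρ : FramedGaloisRep K (PadicAlgCl p) 2)
    (hns : ¬ IsSolvable ρ.residualRep.range) (k : Type) [Field k] [TopologicalSpace k]
    [DiscreteTopology k] (ι : padicAlgClResidueField p →+* k) :
    ∃ τ : FramedGaloisRep K k 2,
      (τ : absoluteGaloisGroup K →* GL (Fin 2) k) =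
          (Matrix.GeneralLinearGroup.map ι).comp ρ.residualRep ∧
        τ.toGaloisRep.IsIrreducible := by
  classical
  have hex : ∃ τ, ρ.IsResidualRepOf (RingHom.id _) τ := by
    by_contra h
    apply hns
    have h1 : ρ.residualRep = 1 := by
      rw [FramedGaloisRep.residualRep, dif_neg h]
    rw [h1, MonoidHom.range_one]
    infer_instance
  have hker := isOpen_ker_residualRepChosen ρ hex
  set σ : absoluteGaloisGroup K →* GL (Fin 2) k :=
    (Matrix.GeneralLinearGroup.map ι).comp ρ.residualRep with hσ
  have hσker : IsOpen (σ.ker : Set (absoluteGaloisGroup K)) := by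
    refine Subgroup.isOpen_mono ?_ hker
    intro g hg
    rw [MonoidHom.mem_ker] at hg ⊢
    rw [hσ, MonoidHom.comp_apply, hg, map_one]
  let τ : FramedGaloisRep K k 2 := ⟨σ, MonoidHom.continuous_of_isOpen_ker σ hσker⟩
  refine ⟨τ, rfl, ?_⟩
  by_contra hirr
  have hsol : IsSolvable σ.range :=
    Summit.Langlands.Langlands.Theorems.ResidualBianchiDoorMod2.isSolvable_range_of_not_isIrreducible σ hirr
  apply hns
  have hinj : Function.Injective (Matrix.GeneralLinearGroup.map (n := Fin 2) ι) :=
    generalLinearGroup_map_injective_of_injective ι ι.injective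
  have hmem : ∀ x : ρ.residualRep.range,
      Matrix.GeneralLinearGroup.map ι (x : GL (Fin 2) _) ∈ σ.range := by
    rintro ⟨_, g, rfl⟩
    exact ⟨g, rfl⟩
  let f : ρ.residualRep.range →* σ.range :=
    { toFun := fun x => ⟨Matrix.GeneralLinearGroup.map ι (x : GL (Fin 2) _), hmem x⟩
      map_one' := by ext1; simp
      map_mul' := fun x y => by ext1; simp }
  have hf : Function.Injective f := by
    rintro ⟨a, ha⟩ ⟨b, hb⟩ h
    have h' : Matrix.GeneralLinearGroup.map ι a = Matrix.GeneralLinearGroup.map ι b :=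
      congrArg Subtype.val h
    exact Subtype.ext (hinj h')
  exact solvable_of_solvable_injective hf

end SerreAvatar

/-! ## The crux from the two named facts -/

/-- **`DyadicNonsolvableFM` from Tung 2020 and Khare–Wintenberger** (CONDITIONAL on the two named
facts, D-0014).  At `ℓ = 2`, for `ρ` as in the crux: over the algebraically closed discrete model
`k = \overline{ℤ̄₂/𝔪}` (characteristic `2`, `charP_padicAlgClResidueField`) the Serre avatar `τ` of
`ρ̄` (`exists_discreteModel_residualRep`) is irreducible and odd (`-1 = 1`, `isOdd_of_charP_two`), so
`khare_wintenberger 2 k` makes it arise from a newform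
(`exists_newform_of_odd_irreducible_of_khare_wintenberger`) — Tung's hypothesis "`ρ̄` is modular" —
whence Tung's Theorem 1 gives a newform `f` carrying a Tate twist `ρ ⊗ ε₂^m`, and
`exists_cuspidal_satakeFrobCompatible_of_tateTwistNewform` converts it into the `L`-algebraic
cuspidal `π`.  The hypothesis `ρ.IsResiduallyAbsIrreducible` of the crux is not used (it follows
from non-solvability). [cite: Tung2020, Thm. 1 (Introduction) and Thm. 8.0.4]
[cite: KhareWintenberger2009, Thm. 1.2 and Thm. 9.1] -/
theorem dyadicNonsolvableFM_of_Tung2020 (hT : Tung2020_fontaineMazurGL2_two_tateTwist)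
    (hKW : ∀ (k : Type) [Field k] [TopologicalSpace k] [DiscreteTopology k],
      khare_wintenberger 2 k) :
    Summit.Langlands.Langlands.Theses.DyadicOddResidue.DyadicNonsolvableFM := by
  intro ℓ _ hℓ ρ _hres hns hirr hodd hunr hdR hcpt ι
  subst hℓ
  -- the model `k = \overline{ℤ̄₂/𝔪}` with the discrete topology
  let k : Type := AlgebraicClosure (padicAlgClResidueField 2)
  letI : TopologicalSpace k := ⊥
  haveI : DiscreteTopology k := ⟨rfl⟩
  haveI : CharP k 2 := by
    haveI : CharP (padicAlgClResidueField 2) 2 := charP_padicAlgClResidueField 2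
    exact (Algebra.charP_iff (padicAlgClResidueField 2) k 2).mp inferInstance
  obtain ⟨τ, hτ, hirrτ⟩ :=
    exists_discreteModel_residualRep ρ hns k (algebraMap (padicAlgClResidueField 2) k)
  have hmod := exists_newform_of_odd_irreducible_of_khare_wintenberger 2 k (hKW k) τ hirrτ
    (ResidualBianchiDoorMod2.isOdd_of_charP_two τ)
  obtain ⟨χ, m, hχ, N, _, w, f, ιf, hf, hρ'⟩ :=
    hT ρ hunr hirr hodd hdR hns k (algebraMap _ k) τ hτ hmod
  exact exists_cuspidal_satakeFrobCompatible_of_tateTwistNewform ρ hχ hf hρ' hcpt ι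

/-- **Registered stub of line `Sketch` (crux stmt-Langlands-18744)**: the crux from its two named
facts, Tung 2020 Thm. 1 (`Tung2020_fontaineMazurGL2_two_tateTwist`) and Khare–Wintenberger at `p = 2`
(`khare_wintenberger 2 k`) — the registered signature, proved by `dyadicNonsolvableFM_of_Tung2020`.
[cite: Tung2020, Thm. 1] [cite: KhareWintenberger2009, Thm. 1.2 and Thm. 9.1] -/
theorem stub_dyadicNonsolvableFM_of_facts :
    Tung2020_fontaineMazurGL2_two_tateTwist →
      (∀ (k : Type) [Field k] [TopologicalSpace k] [DiscreteTopology k], khare_wintenberger 2 k) →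
      Summit.Langlands.Langlands.Theses.DyadicOddResidue.DyadicNonsolvableFM :=
  fun hT hKW => dyadicNonsolvableFM_of_Tung2020 hT hKW

/-! ## Sharper trust base: Tung 2020 and the WEAK form of Serre's conjecture at `2`

Tung's residual hypothesis (RM) "`ρ̄` is modular" is rendered in the named fact
`Tung2020_fontaineMazurGL2_two_tateTwist` clause for clause as the body of the WEAK form (Serre 1987,
(3.2.3): some level, some weight) of Serre's conjecture, `exists_newform_of_odd_irreducible` at
`p = 2`, for the Serre avatar `τ` of `ρ̄`.  So the crux already follows from Tung's Theorem 1 and that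
weak form, with no appeal to the level-`N(ρ̄)` / weight-`k(ρ̄)` refinement (3.2.4) carried by the
strong form `khare_wintenberger 2 k` used in `dyadicNonsolvableFM_of_Tung2020` (at `p = 2` the weak
form does not give the strong form back by the classical level-lowering / weight-optimisation
arguments, which are stated for `p > 2`).  The strong form implies the weak one
(`exists_newform_of_odd_irreducible_of_khare_wintenberger`), so the earlier conditional theorem is the
corollary `dyadicNonsolvableFM_of_Tung2020_of_serreWeak hT (serreWeak_two_of_khare_wintenberger_two hKW)`.
-/

/-- **At `p = 2` the strong form of Serre's conjecture gives the weak form, uniformly in the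
coefficient field**: if `khare_wintenberger 2 k` (Serre (3.2.4): level `N(ρ̄)`, weight `k(ρ̄)`) holds
for every discrete field `k`, then so does the weak form `exists_newform_of_odd_irreducible` (Serre
(3.2.3): some level and weight) — the proved glue
`exists_newform_of_odd_irreducible_of_khare_wintenberger` of `SerreConjectureProofs`, field by field.
[cite: KhareWintenberger2009, Thm. 1.2 and Thm. 9.1 (with Serre, Duke Math. J. 54 (1987), (3.2.3)–(3.2.4))] -/
theorem serreWeak_two_of_khare_wintenberger_two
    (hKW : ∀ (k : Type) [Field k] [TopologicalSpace k] [DiscreteTopology k],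
      khare_wintenberger 2 k) :
    ∀ (k : Type) [Field k] [TopologicalSpace k] [DiscreteTopology k],
      @exists_newform_of_odd_irreducible 2 k _ _ _ :=
  fun k _ _ _ => exists_newform_of_odd_irreducible_of_khare_wintenberger 2 k (hKW k)

/-- **`DyadicNonsolvableFM` from Tung 2020 and the WEAK form of Serre's conjecture at `p = 2`**
(CONDITIONAL on the two named facts, D-0014; trust base
{`Tung2020_fontaineMazurGL2_two_tateTwist`, `exists_newform_of_odd_irreducible` at `p = 2`}, the
second being implied by — and at `p = 2` formally weaker than — `khare_wintenberger 2 ·`).  At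
`ℓ = 2`, for `ρ` as in the crux: over the algebraically closed discrete model `k = \overline{ℤ̄₂/𝔪}`
(characteristic `2`, `charP_padicAlgClResidueField`) the Serre avatar `τ` of `ρ̄`
(`exists_discreteModel_residualRep`) is irreducible and odd (`-1 = 1`, `isOdd_of_charP_two`), so the
weak form of Serre's conjecture makes it arise from SOME newform — literally Tung's hypothesis
"`ρ̄` is modular" as rendered in the fact — whence Tung's Theorem 1 gives a newform `f` carrying a
Tate twist `ρ ⊗ ε₂^m`, and `exists_cuspidal_satakeFrobCompatible_of_tateTwistNewform` converts it
into the `L`-algebraic cuspidal `π`.  The hypothesis `ρ.IsResiduallyAbsIrreducible` of the crux is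
not used (it follows from non-solvability). [cite: Tung2020, Thm. 1 (Introduction) and Thm. 8.0.4]
[cite: KhareWintenberger2009, Thm. 1.2 and Thm. 9.1 (with Serre, Duke Math. J. 54 (1987), (3.2.3))] -/
theorem dyadicNonsolvableFM_of_Tung2020_of_serreWeak (hT : Tung2020_fontaineMazurGL2_two_tateTwist)
    (hS : ∀ (k : Type) [Field k] [TopologicalSpace k] [DiscreteTopology k],
      @exists_newform_of_odd_irreducible 2 k _ _ _) :
    Summit.Langlands.Langlands.Theses.DyadicOddResidue.DyadicNonsolvableFM := by
  intro ℓ _ hℓ ρ _hres hns hirr hodd hunr hdR hcpt ι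
  subst hℓ
  -- the model `k = \overline{ℤ̄₂/𝔪}` with the discrete topology
  let k : Type := AlgebraicClosure (padicAlgClResidueField 2)
  letI : TopologicalSpace k := ⊥
  haveI : DiscreteTopology k := ⟨rfl⟩
  haveI : CharP k 2 := by
    haveI : CharP (padicAlgClResidueField 2) 2 := charP_padicAlgClResidueField 2
    exact (Algebra.charP_iff (padicAlgClResidueField 2) k 2).mp inferInstance
  obtain ⟨τ, hτ, hirrτ⟩ :=
    exists_discreteModel_residualRep ρ hns k (algebraMap (padicAlgClResidueField 2) k)
  -- Tung's hypothesis (RM) for the avatar `τ`, by the weak form of Serre's conjecture at `2`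
  have hmod := hS k τ hirrτ (ResidualBianchiDoorMod2.isOdd_of_charP_two τ)
  obtain ⟨χ, m, hχ, N, _, w, f, ιf, hf, hρ'⟩ :=
    hT ρ hunr hirr hodd hdR hns k (algebraMap _ k) τ hτ hmod
  exact exists_cuspidal_satakeFrobCompatible_of_tateTwistNewform ρ hχ hf hρ' hcpt ι

/-- **The strong-form conditional theorem is a corollary of the weak-form one** (same trust base as
`dyadicNonsolvableFM_of_Tung2020`, routed through `dyadicNonsolvableFM_of_Tung2020_of_serreWeak` and
`serreWeak_two_of_khare_wintenberger_two`): recorded so that the registered stub of line `Sketch`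
may be weakened from `khare_wintenberger 2 ·` to `exists_newform_of_odd_irreducible` at `2` without
losing the composition. [cite: Tung2020, Thm. 1] [cite: KhareWintenberger2009, Thm. 1.2 and Thm. 9.1] -/
theorem dyadicNonsolvableFM_of_Tung2020_of_khare_wintenberger_two
    (hT : Tung2020_fontaineMazurGL2_two_tateTwist)
    (hKW : ∀ (k : Type) [Field k] [TopologicalSpace k] [DiscreteTopology k],
      khare_wintenberger 2 k) :
    Summit.Langlands.Langlands.Theses.DyadicOddResidue.DyadicNonsolvableFM :=
  dyadicNonsolvableFM_of_Tung2020_of_serreWeak hT (serreWeak_two_of_khare_wintenberger_two hKW)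

/-- **Registered stub of line `Sketch`, revision 4 (crux stmt-Langlands-18744)**: the crux from
Tung 2020 Thm. 1 (`Tung2020_fontaineMazurGL2_two_tateTwist`) and the WEAK form of Serre's conjecture
at `p = 2` (`exists_newform_of_odd_irreducible`, some level and weight) — the registered signature,
proved by `dyadicNonsolvableFM_of_Tung2020_of_serreWeak`. [cite: Tung2020, Thm. 1]
[cite: KhareWintenberger2009, Thm. 1.2 and Thm. 9.1 (with Serre, Duke Math. J. 54 (1987), (3.2.3))] -/
theorem stub_dyadicNonsolvableFM_of_serreWeak :
    Tung2020_fontaineMazurGL2_two_tateTwist →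
      (∀ (k : Type) [Field k] [TopologicalSpace k] [DiscreteTopology k],
        @exists_newform_of_odd_irreducible 2 k _ _ _) →
      Summit.Langlands.Langlands.Theses.DyadicOddResidue.DyadicNonsolvableFM :=
  fun hT hS => dyadicNonsolvableFM_of_Tung2020_of_serreWeak hT hS

end Summit.Langlands.Langlands.Theorems

end
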